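import Literature.AlgebraicGeometry.Motives.GrassmannianPluckerCharts
import Mathlib.RingTheory.LocalProperties.Submodule
import Mathlib.RingTheory.Localization.BaseChange
import HarnessLib

/-!
# The Plücker map is injective on points: `plucker N₁ = plucker N₂ → N₁ = N₂`

Topic `AlgebraicGeometry/Motives`; namespace `Literature.AlgebraicGeometry.Motives.Grassmannian`.  THEOREMS ONLY (no definition,
no instance, no notation, no named fact, no `sorry`); sequel of `Motives/GrassmannianPluckerMap` / `…PluckerCharts`.

[GortzWedhorn2020, (8.10) Prop. 8.23 (p. 220)] «The Plücker embedding is a closed immersion» — in particular a MONOMORPHISM,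
i.e. injective on `T`-valued points; [EisenbudHarris2016, §3.2.2] (a `k`-plane is recovered from its Plücker coordinates: on
the chart `U_I` the entries of the normalised matrix are, up to sign, the Plücker coordinates `p_{I − i + j}`).  On the ring side
of the tree's Grassmannian functor:

* §1 `exists_topCoord` — a coordinate `τ : ⋀ᵏ_A Aᵏ → A`, injective with `τ (e₁ ∧ ⋯ ∧ e_k) = 1` (Mathlib `Basis.exteriorPower`,
  ★ `eq_repr_smul_ιMulti`).
* §2 **chart case `eq_of_plucker_eq_of_mem_chart`**: for `N₁, N₂ ∈ U_x(A)` with `plucker N₁ = plucker N₂`, `N₁ = N₂` — the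
  normalised determinant functionals `δᵢ = τ ∘ ⋀ᵏ(ψᵢ)` (`ψᵢ : A ⊗ M → Aᵏ` the coordinate map of `Nᵢ`, `ker ψᵢ = Nᵢ`) have the
  same kernel and the same value `1` on `[1⊗x₁] ∧ ⋯ ∧ [1⊗x_k]`, hence coincide, and `ψᵢ(y)ⱼ = δᵢ([1⊗x₁] ∧ ⋯ ∧ y ∧ ⋯ ∧ [1⊗x_k])`
  (`y` in slot `j`) recovers `ψᵢ` from `δᵢ`.
* §3 `exists_mem_chart_of_isLocalRing` — over a LOCAL ring every point lies in a standard chart (★ `exists_frame_mem_chart_of_field`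
  at the closed point + openness ★ `isOpen_setOf_map_residueField_mem_chart` + ★ `mem_chart_iff_forall_residueField`).
* §4 **`plucker_injective`** over EVERY commutative `R`-algebra `A`: localise at each maximal ideal (naturality ★ `map_plucker`,
  §3, chart compatibility ★ `plucker_mem_chart_iff`, §2), then glue with Mathlib `Module.eq_zero_of_localization_maximal`.

Cell `hodgecm-mathlib` (D-0151), F-DAG hand «Plücker» (F-5 (a)); count-neutral Mathlib-side capital; nothing here is about HC —
HC_CM is proved only modulo the 7 printed citations until rung 0 closes.

## References
* [GortzWedhorn2020] U. Görtz, T. Wedhorn, *Algebraic Geometry I*, 2nd ed. (2020), (8.10), Prop. 8.23 (p. 220).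
* [EisenbudHarris2016] D. Eisenbud, J. Harris, *3264 and All That* (2016), §3.2.2.
* [StacksProject] The Stacks project, Tag 089T; Tag 00HN (zero is a local property).
-/

set_option autoImplicit false

noncomputable section

universe u v w

open TensorProduct Function
open Literature.LinearAlgebra.Alternating

namespace Literature.AlgebraicGeometry.Motives

namespace Grassmannian

variable {R : Type u} [CommRing R] {M : Type v} [AddCommGroup M] [Module R M] {k : ℕ}
variable {A : Type w} [CommRing A] [Algebra R A]

/-! ## §1 The top coordinate on `⋀ᵏ Aᵏ` -/

/-- **A normalised coordinate on the top exterior power `⋀ᵏ_A Aᵏ`**: an injective `A`-linear `τ : ⋀ᵏ Aᵏ → A` with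
`τ (e₁ ∧ ⋯ ∧ e_k) = 1` (the coordinate on Mathlib's one-element basis `Basis.exteriorPower`; ★ `eq_repr_smul_ιMulti`).
[cite: GortzWedhorn2020, (8.10) Prop. 8.23 (p. 220)] -/
theorem exists_topCoord (A : Type w) [CommRing A] (k : ℕ) :
    ∃ τ : ⋀[A]^k (Fin k → A) →ₗ[A] A,
      Injective τ ∧ τ (exteriorPower.ιMulti A k ⇑(Pi.basisFun A (Fin k))) = 1 := by
  let b := Pi.basisFun A (Fin k)
  let s₀ : Set.powersetCard (Fin k) k :=
    ⟨Finset.univ, Set.powersetCard.mem_iff.mpr (by rw [Finset.card_univ, Fintype.card_fin])⟩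
  refine ⟨(b.exteriorPower k).coord s₀, fun z z' h => ?_, ?_⟩
  · rw [eq_repr_smul_ιMulti b s₀ z, eq_repr_smul_ιMulti b s₀ z']
    change (b.exteriorPower k).repr z s₀ = (b.exteriorPower k).repr z' s₀ at h
    rw [h]
  · rw [← exteriorPower_basis_apply_eq_ιMulti b s₀, Module.Basis.coord_apply, Module.Basis.repr_self,
      Finsupp.single_eq_same]

/-- Two linear functionals with the same kernel and the same value `1` at one vector coincide. [folklore] -/
private theorem linearMap_eq_of_ker_eq_of_apply_eq_one {V : Type*} [AddCommGroup V] [Module A V] {δ₁ δ₂ : V →ₗ[A] A}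
    (hker : LinearMap.ker δ₁ = LinearMap.ker δ₂) {w : V} (h₁ : δ₁ w = 1) (h₂ : δ₂ w = 1) : δ₁ = δ₂ := by
  ext v
  have hv : v - δ₁ v • w ∈ LinearMap.ker δ₂ := by
    rw [← hker, LinearMap.mem_ker, map_sub, map_smul, h₁, smul_eq_mul, mul_one, sub_self]
  rw [LinearMap.mem_ker, map_sub, map_smul, h₂, smul_eq_mul, mul_one, sub_eq_zero] at hv
  exact hv.symm

/-! ## §2 The chart case -/

/-- The kernel of the Plücker linear map, pushed to `⋀ᵏ_A (A ⊗ M)`: `plucker N = θ⁻¹ (ker ⋀ᵏ(mkQ_N))`.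
[cite: GortzWedhorn2020, (8.10) Prop. 8.23 (p. 220)] -/
theorem plucker_toSubmodule_eq_comap (N : Module.Grassmannian A (A ⊗[R] M) k) :
    (plucker N).toSubmodule =
      (LinearMap.ker (exteriorPower.map k N.toSubmodule.mkQ)).comap (exteriorPowerBaseChange R A k M) := by
  rw [plucker_toSubmodule, pluckerLinearMap, LinearMap.ker_comp]

/-- Equal Plücker points have equal `ker ⋀ᵏ(mkQ)` in `⋀ᵏ_A (A ⊗ M)` (`θ` is surjective, ★ `exteriorPowerBaseChange_surjective`).
[cite: GortzWedhorn2020, (8.10) Prop. 8.23 (p. 220)] -/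
theorem ker_map_mkQ_eq_of_plucker_eq {N₁ N₂ : Module.Grassmannian A (A ⊗[R] M) k} (h : plucker N₁ = plucker N₂) :
    LinearMap.ker (exteriorPower.map k N₁.toSubmodule.mkQ) = LinearMap.ker (exteriorPower.map k N₂.toSubmodule.mkQ) := by
  apply Submodule.comap_injective_of_surjective (exteriorPowerBaseChange_surjective R A k M)
  rw [← plucker_toSubmodule_eq_comap, ← plucker_toSubmodule_eq_comap, h]

/-- **Chart case of injectivity**: two points of the SAME standard chart `U_x(A)` with the same Plücker point are equal.
With `ψᵢ : A ⊗ M → Aᵏ` the coordinate map of `Nᵢ` (`ker ψᵢ = Nᵢ`, `ψᵢ [1⊗xⱼ] = eⱼ`) and `τ` the top coordinate of §1, the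
functionals `δᵢ := τ ∘ ⋀ᵏ ψᵢ` on `⋀ᵏ_A (A ⊗ M)` have kernel `ker ⋀ᵏ(mkQ_{Nᵢ})` (equal for `i = 1, 2`) and value `1` at
`[1⊗x₁] ∧ ⋯ ∧ [1⊗x_k]`, so `δ₁ = δ₂`; and `(ψᵢ y)ⱼ = δᵢ (⋯ ∧ y ∧ ⋯)` (`y` in slot `j`).
[cite: GortzWedhorn2020, (8.10) Prop. 8.23 (p. 220)] [cite: EisenbudHarris2016, §3.2.2] -/
theorem eq_of_plucker_eq_of_mem_chart (x : Fin k → M) {N₁ N₂ : Module.Grassmannian A (A ⊗[R] M) k}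
    (h₁ : N₁ ∈ chart R M k x A) (h₂ : N₂ ∈ chart R M k x A) (h : plucker N₁ = plucker N₂) : N₁ = N₂ := by
  classical
  obtain ⟨τ, hτ, hτ1⟩ := exists_topCoord A k
  -- the frame of `A ⊗ M` and the standard basis of `Aᵏ`
  let xt : Fin k → A ⊗[R] M := fun j => (1 : A) ⊗ₜ[R] x j
  let b : Fin k → (Fin k → A) := ⇑(Pi.basisFun A (Fin k))
  -- coordinate maps
  let ψ : ∀ (N : Module.Grassmannian A (A ⊗[R] M) k), N ∈ chart R M k x A → ((A ⊗[R] M) →ₗ[A] (Fin k → A)) :=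
    fun N hN => (frameEquiv x N hN).symm.toLinearMap ∘ₗ N.toSubmodule.mkQ
  have hψker : ∀ N hN, LinearMap.ker (ψ N hN) = N.toSubmodule := fun N hN => by
    change LinearMap.ker ((frameEquiv x N hN).symm.toLinearMap ∘ₗ N.toSubmodule.mkQ) = _
    rw [LinearMap.ker_comp_of_ker_eq_bot _ (LinearEquiv.ker _), Submodule.ker_mkQ]
  have hψx : ∀ N hN, ⇑(ψ N hN) ∘ xt = b := fun N hN => by
    funext j
    change (frameEquiv x N hN).symm (N.toSubmodule.mkQ ((1 : A) ⊗ₜ[R] x j)) = Pi.basisFun A (Fin k) j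
    rw [LinearEquiv.symm_apply_eq, Pi.basisFun_apply, frameEquiv_apply, frameMap_single]
  -- determinant functionals
  let δ : ∀ (N : Module.Grassmannian A (A ⊗[R] M) k), N ∈ chart R M k x A → (⋀[A]^k (A ⊗[R] M) →ₗ[A] A) :=
    fun N hN => τ ∘ₗ exteriorPower.map k (ψ N hN)
  have hδker : ∀ N hN, LinearMap.ker (δ N hN) = LinearMap.ker (exteriorPower.map k N.toSubmodule.mkQ) := fun N hN => by
    change LinearMap.ker (τ ∘ₗ exteriorPower.map k ((frameEquiv x N hN).symm.toLinearMap ∘ₗ N.toSubmodule.mkQ)) = _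
    rw [LinearMap.ker_comp_of_ker_eq_bot _ (LinearMap.ker_eq_bot.mpr hτ), exteriorPower.map_comp,
      LinearMap.ker_comp_of_ker_eq_bot]
    exact LinearMap.ker_eq_bot.mpr (exteriorPower.map_injective (frameEquiv x N hN).toLinearMap
      (by rw [← LinearEquiv.coe_trans, LinearEquiv.symm_trans_self, LinearEquiv.refl_toLinearMap]))
  have hδ1 : ∀ N hN, δ N hN (exteriorPower.ιMulti A k xt) = 1 := fun N hN => by
    change τ (exteriorPower.map k (ψ N hN) (exteriorPower.ιMulti A k xt)) = 1
    rw [exteriorPower.map_apply_ιMulti, hψx]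
    exact hτ1
  have hδeq : δ N₁ h₁ = δ N₂ h₂ :=
    linearMap_eq_of_ker_eq_of_apply_eq_one
      (by rw [hδker, hδker, ker_map_mkQ_eq_of_plucker_eq h]) (hδ1 N₁ h₁) (hδ1 N₂ h₂)
  -- recovering `ψ` from `δ`: the `j`-th coordinate of `v ∈ Aᵏ` is `τ (e₁ ∧ ⋯ ∧ v ∧ ⋯ ∧ e_k)`
  have hcoord : ∀ (j : Fin k) (v : Fin k → A), τ (exteriorPower.ιMulti A k (Function.update b j v)) = v j := by
    intro j v
    let L : (Fin k → A) →ₗ[A] A :=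
      τ ∘ₗ (exteriorPower.ιMulti A k (M := Fin k → A)).toMultilinearMap.toLinearMap b j
    have hL : L = LinearMap.proj j := by
      refine (Pi.basisFun A (Fin k)).ext fun i => ?_
      change τ (exteriorPower.ιMulti A k (Function.update b j (b i))) = (Pi.basisFun A (Fin k) i) j
      by_cases hij : i = j
      · subst hij
        rw [Function.update_eq_self, hτ1, Pi.basisFun_apply, Pi.single_eq_same]
      · rw [Pi.basisFun_apply, Pi.single_eq_of_ne (Ne.symm hij),
          (exteriorPower.ιMulti A k).map_eq_zero_of_eq (Function.update b j (b i)) (i := i) (j := j)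
            (by rw [Function.update_self, Function.update_of_ne hij]) hij, map_zero]
    have hLv := LinearMap.congr_fun hL v
    change τ (exteriorPower.ιMulti A k (Function.update b j v)) = v j at hLv
    exact hLv
  have hψδ : ∀ N hN (y : A ⊗[R] M) (j : Fin k),
      ψ N hN y j = δ N hN (exteriorPower.ιMulti A k (Function.update xt j y)) := fun N hN y j => by
    change _ = τ (exteriorPower.map k (ψ N hN) (exteriorPower.ιMulti A k (Function.update xt j y)))
    rw [exteriorPower.map_apply_ιMulti, Function.comp_update, hψx, hcoord]
  -- conclude
  have hψeq : ψ N₁ h₁ = ψ N₂ h₂ := by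
    refine LinearMap.ext fun y => funext fun j => ?_
    rw [hψδ, hψδ, hδeq]
  ext : 1
  rw [← hψker N₁ h₁, ← hψker N₂ h₂, hψeq]

/-! ## §3 Over a local ring every point lies in a standard chart -/

/-- **Over a local ring `A`, every `N ∈ G(k, A ⊗ M; A)` lies in some standard chart `U_x(A)`**: the residue-field point at the
closed point lies in some `U_x(κ)` (★ `exists_frame_mem_chart_of_field`), the locus `{𝔭 | N ⊗ κ(𝔭) ∈ U_x}` is open (★) and contains
the closed point, hence is everything, and chart membership is tested on residue fields (★ `mem_chart_iff_forall_residueField`).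
[cite: StacksProject, Tag 089T] -/
theorem exists_mem_chart_of_isLocalRing [IsLocalRing A] (N : Module.Grassmannian A (A ⊗[R] M) k) :
    ∃ x : Fin k → M, N ∈ chart R M k x A := by
  obtain ⟨x, hx⟩ := exists_frame_mem_chart_of_field
    (Module.Grassmannian.map (IsScalarTower.toAlgHom R A (IsLocalRing.closedPoint A).asIdeal.ResidueField) N)
  refine ⟨x, (mem_chart_iff_forall_residueField x N).mpr fun p => ?_⟩
  exact (IsLocalRing.specializes_closedPoint p).mem_open (isOpen_setOf_map_residueField_mem_chart x N) hx

/-! ## §4 Injectivity over any ring -/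

/-- The submodule of `map (A → B) N` for a given `A`-ALGEBRA `B` (the instance-level form of Mathlib's `map_toSubmodule`, which is
stated with `f.toAlgebra`): it is the kernel of `baseChangeMkQ B N : B ⊗_R M → B ⊗_A ((A ⊗ M)⧸N)`. [cite: StacksProject, Tag 089R] -/
theorem map_toAlgHom_toSubmodule (B : Type w) [CommRing B] [Algebra R B] [Algebra A B] [IsScalarTower R A B]
    (N : Module.Grassmannian A (A ⊗[R] M) k) :
    (Module.Grassmannian.map (IsScalarTower.toAlgHom R A B) N).toSubmodule =
      LinearMap.ker (Module.Grassmannian.baseChangeMkQ B N.toSubmodule) := by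
  have hA : (IsScalarTower.toAlgHom R A B).toRingHom.toAlgebra = ‹Algebra A B› :=
    Algebra.algebra_ext _ _ fun a => rfl
  have h := Module.Grassmannian.map_toSubmodule (IsScalarTower.toAlgHom R A B) N
  rw [h]
  congr 3 <;> first | exact hA | subsingleton

/-- Pushing a membership `y ∈ N` to the base change: `1 ⊗ y ∈ B ⊗_A (A ⊗_R M) ≅ B ⊗_R M` lies in `map (A → B) N`, and
`baseChangeMkQ B N` of it is `1 ⊗ [y]`. [cite: StacksProject, Tag 089R] -/
theorem baseChangeMkQ_cancelBaseChange_one_tmul (B : Type w) [CommRing B] [Algebra R B] [Algebra A B] [IsScalarTower R A B]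
    (N : Submodule A (A ⊗[R] M)) (y : A ⊗[R] M) :
    Module.Grassmannian.baseChangeMkQ B N (AlgebraTensorModule.cancelBaseChange R A B B M ((1 : B) ⊗ₜ[A] y)) =
      (1 : B) ⊗ₜ[A] N.mkQ y := by
  change (N.mkQ.baseChange B) ((AlgebraTensorModule.cancelBaseChange R A B B M).symm
    (AlgebraTensorModule.cancelBaseChange R A B B M ((1 : B) ⊗ₜ[A] y))) = _
  rw [LinearEquiv.symm_apply_apply, LinearMap.baseChange_tmul]

/-- If `map (A → B) N₁ = map (A → B) N₂` for an `A`-algebra `B` and `y ∈ N₁`, then `1 ⊗ [y]_{N₂} = 0` in `B ⊗_A Q_{N₂}`.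
[cite: StacksProject, Tag 089R] -/
theorem one_tmul_mkQ_eq_zero_of_map_eq (B : Type w) [CommRing B] [Algebra R B] [Algebra A B] [IsScalarTower R A B]
    {N₁ N₂ : Module.Grassmannian A (A ⊗[R] M) k}
    (h : Module.Grassmannian.map (IsScalarTower.toAlgHom R A B) N₁ = Module.Grassmannian.map (IsScalarTower.toAlgHom R A B) N₂)
    {y : A ⊗[R] M} (hy : y ∈ N₁.toSubmodule) :
    (1 : B) ⊗ₜ[A] N₂.toSubmodule.mkQ y = (0 : B ⊗[A] ((A ⊗[R] M) ⧸ N₂.toSubmodule)) := by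
  have hz : AlgebraTensorModule.cancelBaseChange R A B B M ((1 : B) ⊗ₜ[A] y) ∈
      (Module.Grassmannian.map (IsScalarTower.toAlgHom R A B) N₁).toSubmodule := by
    rw [map_toAlgHom_toSubmodule, LinearMap.mem_ker, baseChangeMkQ_cancelBaseChange_one_tmul, Submodule.mkQ_apply,
      (Submodule.Quotient.mk_eq_zero _).mpr hy, tmul_zero]
  rw [h, map_toAlgHom_toSubmodule, LinearMap.mem_ker, baseChangeMkQ_cancelBaseChange_one_tmul] at hz
  exact hz

/-- Local-to-global: if `map (A → A_𝔪) N₁ = map (A → A_𝔪) N₂` for every maximal ideal `𝔪`, then `N₁ ≤ N₂` (an element of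
`Q_{N₂}` vanishing in every localisation `A_𝔪 ⊗_A Q_{N₂}` is zero, Mathlib `Module.eq_zero_of_localization_maximal`).
[cite: StacksProject, Tag 00HN] -/
theorem le_of_forall_map_localization_eq {N₁ N₂ : Module.Grassmannian A (A ⊗[R] M) k}
    (h : ∀ (P : Ideal A) [P.IsMaximal],
      Module.Grassmannian.map (IsScalarTower.toAlgHom R A (Localization.AtPrime P)) N₁ =
        Module.Grassmannian.map (IsScalarTower.toAlgHom R A (Localization.AtPrime P)) N₂) :
    N₁.toSubmodule ≤ N₂.toSubmodule := by
  intro y hy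
  rw [← Submodule.Quotient.mk_eq_zero, ← Submodule.mkQ_apply]
  refine Module.eq_zero_of_localization_maximal
    (fun P _ => Localization.AtPrime P ⊗[A] ((A ⊗[R] M) ⧸ N₂.toSubmodule))
    (fun P _ => TensorProduct.mk A (Localization.AtPrime P) ((A ⊗[R] M) ⧸ N₂.toSubmodule) 1)
    (N₂.toSubmodule.mkQ y) fun P _ => ?_
  rw [TensorProduct.mk_apply]
  exact one_tmul_mkQ_eq_zero_of_map_eq (Localization.AtPrime P) (h P) hy

/-- **THE PLÜCKER MAP IS INJECTIVE ON POINTS**: `plucker : G(k, A ⊗ M; A) → G(1, A ⊗ ⋀ᵏ M; A)` is injective for every commutative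
`R`-algebra `A`.  Localise at a maximal ideal `𝔪`: by naturality (★ `map_plucker`) the localised points still have equal Plücker
points; over the local ring `A_𝔪` the first lies in a standard chart `U_x` (§3) and then so does the second (★ `plucker_mem_chart_iff`),
so they are equal by the chart case (§2); glue (`le_of_forall_map_localization_eq`).
[cite: GortzWedhorn2020, (8.10) Prop. 8.23 (p. 220)] [cite: EisenbudHarris2016, §3.2.2] -/
theorem plucker_injective :
    Injective (plucker : Module.Grassmannian A (A ⊗[R] M) k → Module.Grassmannian A (A ⊗[R] ⋀[R]^k M) 1) := by
  intro N₁ N₂ h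
  have hloc : ∀ (P : Ideal A) [P.IsMaximal],
      Module.Grassmannian.map (IsScalarTower.toAlgHom R A (Localization.AtPrime P)) N₁ =
        Module.Grassmannian.map (IsScalarTower.toAlgHom R A (Localization.AtPrime P)) N₂ := by
    intro P _
    have h' : plucker (Module.Grassmannian.map (IsScalarTower.toAlgHom R A (Localization.AtPrime P)) N₁) =
        plucker (Module.Grassmannian.map (IsScalarTower.toAlgHom R A (Localization.AtPrime P)) N₂) := by
      rw [← map_plucker, ← map_plucker, h]
    obtain ⟨x, hx₁⟩ := exists_mem_chart_of_isLocalRing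
      (Module.Grassmannian.map (IsScalarTower.toAlgHom R A (Localization.AtPrime P)) N₁)
    have hx₂ : Module.Grassmannian.map (IsScalarTower.toAlgHom R A (Localization.AtPrime P)) N₂ ∈
        chart R M k x (Localization.AtPrime P) := by
      rw [← plucker_mem_chart_iff, ← h', plucker_mem_chart_iff]
      exact hx₁
    exact eq_of_plucker_eq_of_mem_chart x hx₁ hx₂ h'
  ext : 1
  exact le_antisymm (le_of_forall_map_localization_eq hloc)
    (le_of_forall_map_localization_eq fun P _ => (hloc P).symm)

end Grassmannian

end Literature.AlgebraicGeometry.Motives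

end
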